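import Summits.CriticalPhenomena.PercolationContinuityZ3.Theorems.Transplant.PlanarSkeletonFrmFromDefs
import Summits.CriticalPhenomena.PercolationContinuityZ3.Theorems.Transplant.SkelFrmFrom1RootHoldsQCKV
import Summits.CriticalPhenomena.PercolationContinuityZ3.Theorems.Transplant.SkelFrm1RootHoldsQCKV
import Summits.CriticalPhenomena.PercolationContinuityZ3.Theorems.Transplant.SkelFrmFromBChoiceBridge0
import Summits.CriticalPhenomena.PercolationContinuityZ3.Theorems.Transplant.SkelFrmBChoiceBridge0
import Summits.CriticalPhenomena.PercolationContinuityZ3.Theorems.Transplant.SkelFrmFromBChoiceHopFoot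
import Summits.CriticalPhenomena.PercolationContinuityZ3.Theorems.Transplant.SkelFrmBChoiceHopFoot
import Summits.CriticalPhenomena.PercolationContinuityZ3.Theorems.Transplant.SkelFrmFromBChoiceRootLanding2
import Summits.CriticalPhenomena.PercolationContinuityZ3.Theorems.Transplant.SkelFrmBChoiceRootLanding2
import Summits.CriticalPhenomena.PercolationContinuityZ3.Theorems.Transplant.SkelFrmFromBChoiceRootDepthR
import Summits.CriticalPhenomena.PercolationContinuityZ3.Theorems.Transplant.SkelFrmBChoiceRootDepthR
import Summits.CriticalPhenomena.PercolationContinuityZ3.Theorems.Transplant.SkelFrmFromBChoiceRootLen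
import Summits.CriticalPhenomena.PercolationContinuityZ3.Theorems.Transplant.SkelFrmBChoiceRootLen
import Summits.CriticalPhenomena.PercolationContinuityZ3.Theorems.Transplant.SkelFrmFromBParamsSlotsST
import Summits.CriticalPhenomena.PercolationContinuityZ3.Theorems.Transplant.SkelFrmBParamsSlotsST
import HarnessLib
import Summits.CriticalPhenomena.PercolationContinuityZ3.Theorems.Transplant.SkelFrm1RootHoldsQCKVOfLe
/-!
# U-WAVE PORT (RULING D-U, lead g21 2026-08-26; WAVE-U-MANIFEST v3.0 row «SkelFrm1RootHoldsQCKVOfLe» ↦ «SkelFrmFrom1RootHoldsQCKVOfLe») of the tree module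
# `Transplant/SkelFrm1RootHoldsQCKVOfLe` onto the carrier `PlanarSkeletonFrmFrom` (frames only, cylinders connected from width `ℓ₀` on)

ORIGINAL TITLE: N2 (frames-only node `SamePDropOfSkeletonFrm₁`, OPEN), (R) column: **THE FIRST-AXIS ROOT LEG FROM THE (R) VALUE ROWS** —

builds on p205010 (kernel theorem, internal audit signed; external expert review pending) — nothing in this file uses p205010; NOTHING is claimed about the
OPEN node U `SamePDropOfSkeletonFrmFrom₁` (nor U_s / the end state).  Lane `prim-bschramm`, seat `prim-bschramm-p3` gen 26; helper file
(`--supports stmt-CriticalPhenomena-4575 --as helper`).  PORT RULES r1–r4 of RULING D-U: declaration order and proof texts are those of the original,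
byte-identical except (i) the carrier token `PlanarSkeletonFrm ↦ PlanarSkeletonFrmFrom` (binders, `namespace`/`end` lines, qualified names of twinned
declarations), (ii) carrier-FREE declarations of the original (φ-level `Skelφ…` blocks and namespace-only arithmetic residents) are NOT re-declared —
this file imports the original and `export`s the twin-free residents (POLICY T / treatment (m1)); residents whose statement mentions a twinned
constant are copied, (iii) every carrier-binding declaration keeps its explicit binder `(Φ : PlanarSkeletonFrmFrom G)` in its own signature (r2).  Docstrings and citations are the original's.
-/

noncomputable section

open MeasureTheory ProbabilityTheory
open scoped ENNReal Classical

namespace Summit.CriticalPhenomena.PercolationContinuityZ3.Theorems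

namespace Transplant

open Literature.Probability.Percolation Literature.Probability.LatticeModels SimpleGraph KNCells KNLevels ChainPlanar ChainPara
open Literature.Probability.Percolation.KozmaNitzan.Cells (oth sgOf)
open Literature.Barriers.CriticalPhenomena (graphBall graphBall_mono mem_graphBall_self)
open SkelConc (Consts)
open Skel (winGraph)
open SkelI (tanOff)
open Skelφ (rootFrame RootFootT TargetFootT RootFootV TargetFootV pgSideHalfW kgSL kgZ₀ kgZ₁ kgM₁ kgM₂ kgWm₂ kgWp₂)
open ChainPlanar (ScheduleNP BridgePrm BridgeOK)
open Skelφ.StepI (OutNS)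

namespace PlanarSkeletonFrmFrom

namespace NegB

open Neg

variable {κ : Consts} {V : Type} [DecidableEq V] [Countable V] {G : SimpleGraph V} [G.LocallyFinite] {Φ : PlanarSkeletonFrmFrom G} {t : V} {p : unitInterval}
  {hC : Φ.CylSubcritical p} {gv fv : Neg.FSlot} {Pv : PSlot} {ex mx : GSlot} {cv hv : CSlot} {bv : BSlot} {O : OutNS V} {q : unitInterval}

set_option maxHeartbeats 3200000 in
/-- **THE FIRST-AXIS ROOT LEG AT THE (V) CHOICE FUNCTION OF RECORD FROM THE (R) VALUE ROWS** — the skeleton `rootLegAt_frmQ3KV_fst` with every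
(R)-owned binder discharged; residual = slot floors, window caps, depth numeral, `hRs5`, and the four reading rows (see the module docstring).
[cite: KozmaNitzan2024, §4 p. 28 ((32) at the root)] -/
theorem rootLegAt_frmQ3KV_fst_of_le {κ : Consts} {V : Type} [DecidableEq V] [Countable V] {G : SimpleGraph V} [G.LocallyFinite] {Φ : PlanarSkeletonFrmFrom G} {t : V} {p : unitInterval} {hC : Φ.CylSubcritical p} {gv : Neg.FSlot} {fv : Neg.FSlot} {Pv : PSlot} {ex : GSlot} {mx : GSlot} {cv : CSlot} {hv : CSlot} {bv : BSlot} {O : OutNS V} {q : unitInterval} (hAt : (choiceAtQ3V κ Φ t p Pv gv fv (SUS ex mx) cv hv bv hC).AtQNQ O q) (h1 : Φ.types = {t})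
    (hp0 : 0 < (p : ℝ)) (hp1 : (p : ℝ) < 1) (mk qx Wx Z : ℕ)
    -- slot floors at the evaluated slots `g := gOf …`, `f := fOf …`, `ex`, `Pv`
    (hgK : gFloorKG κ Φ t p O.merged mk ≤ gOf κ Φ t p O gv) (hg2 : 40 * Neg.K κ * KS0.R'0 κ Φ t p O.merged mk ≤ gOf κ Φ t p O gv)
    (hfg : 2 * fOf κ Φ t p O fv + 5 * KS0.R'0 κ Φ t p O.merged mk + 3 ≤ gOf κ Φ t p O gv)
    (hf : KS.fxR0 κ Φ t p O.merged mk ≤ fOf κ Φ t p O fv)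
    (hexRL : KS0.r₀0 t O.merged mk (RL κ Φ t p O gv fv) + 1 ≤ ex κ Φ t p O.merged (gOf κ Φ t p O gv) (fOf κ Φ t p O fv))
    (hexRB : KS0.r₀0 t O.merged mk (KS.RB0 κ Φ t p O.merged mk) + 1 ≤ ex κ Φ t p O.merged (gOf κ Φ t p O gv) (fOf κ Φ t p O fv))
    (hexYb : KS.Yb0 κ Φ t p O.merged mk (gOf κ Φ t p O gv) (fOf κ Φ t p O fv) + 1 ≤ ex κ Φ t p O.merged (gOf κ Φ t p O gv) (fOf κ Φ t p O fv))
    (hexZ : KS.D0s κ Φ t p O.merged mk (gOf κ Φ t p O gv) (fOf κ Φ t p O fv) (kgq κ Φ t p O.merged (gOf κ Φ t p O gv) (fOf κ Φ t p O fv) qx) + Z +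
      13 * (kgSL (nL κ Φ t p O.merged (gOf κ Φ t p O gv) (fOf κ Φ t p O fv)) (ℓL κ Φ t p O.merged (gOf κ Φ t p O gv) (fOf κ Φ t p O fv)) (hL κ Φ t p O.merged (gOf κ Φ t p O gv) (fOf κ Φ t p O fv))).toNat + 1 ≤
        ex κ Φ t p O.merged (gOf κ Φ t p O gv) (fOf κ Φ t p O fv))
    (hPx : (KS.Px0 mk κ Φ t p O.merged).1 ⊆ (Pv κ Φ t p O.merged).1)
    -- the residual window under the Len3 caps, and the depth numeral `Z` bounding (C)'s reach at this window
    (hqx : qx ≤ 100 * nL κ Φ t p O.merged (gOf κ Φ t p O gv) (fOf κ Φ t p O fv))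
    (hWx : (Wx : ℤ) ≤ 20 * kgSL (nL κ Φ t p O.merged (gOf κ Φ t p O gv) (fOf κ Φ t p O fv)) (ℓL κ Φ t p O.merged (gOf κ Φ t p O gv) (fOf κ Φ t p O fv)) (hL κ Φ t p O.merged (gOf κ Φ t p O gv) (fOf κ Φ t p O fv)))
    (hx3 : KGRes3 κ Φ t p O.merged (gOf κ Φ t p O gv) (fOf κ Φ t p O fv) qx Wx)
    (hZ : 13 * ((((kgNv0 κ Φ t p O.merged (gOf κ Φ t p O gv) (fOf κ Φ t p O fv) mk qx Wx : ℕ) : ℤ) + 1) * (nL κ Φ t p O.merged (gOf κ Φ t p O gv) (fOf κ Φ t p O fv) : ℤ) +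
      kgZ₀ (nL κ Φ t p O.merged (gOf κ Φ t p O gv) (fOf κ Φ t p O fv)) (vL κ Φ t p O.merged (gOf κ Φ t p O gv) (fOf κ Φ t p O fv)) (kgR κ Φ t p O.merged mk) 0 (kgq κ Φ t p O.merged (gOf κ Φ t p O gv) (fOf κ Φ t p O fv) qx)
        (kgNv0 κ Φ t p O.merged (gOf κ Φ t p O gv) (fOf κ Φ t p O fv) mk qx Wx)
        (kgM₁ (nL κ Φ t p O.merged (gOf κ Φ t p O gv) (fOf κ Φ t p O fv)) (ℓL κ Φ t p O.merged (gOf κ Φ t p O gv) (fOf κ Φ t p O fv)) (hL κ Φ t p O.merged (gOf κ Φ t p O gv) (fOf κ Φ t p O fv)) (kgR κ Φ t p O.merged mk) 0 (kgW κ Φ t p O.merged (gOf κ Φ t p O gv) (fOf κ Φ t p O fv) Wx)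
          (kgNv0 κ Φ t p O.merged (gOf κ Φ t p O gv) (fOf κ Φ t p O fv) mk qx Wx))
        (kgM₂ (nL κ Φ t p O.merged (gOf κ Φ t p O gv) (fOf κ Φ t p O fv)) (ℓL κ Φ t p O.merged (gOf κ Φ t p O gv) (fOf κ Φ t p O fv)) (hL κ Φ t p O.merged (gOf κ Φ t p O gv) (fOf κ Φ t p O fv)) (vL κ Φ t p O.merged (gOf κ Φ t p O gv) (fOf κ Φ t p O fv)) (kgR κ Φ t p O.merged mk) 0
          (kgq κ Φ t p O.merged (gOf κ Φ t p O gv) (fOf κ Φ t p O fv) qx) (kgW κ Φ t p O.merged (gOf κ Φ t p O gv) (fOf κ Φ t p O fv) Wx) (kgNv0 κ Φ t p O.merged (gOf κ Φ t p O gv) (fOf κ Φ t p O fv) mk qx Wx)) +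
      kgZ₁ (nL κ Φ t p O.merged (gOf κ Φ t p O gv) (fOf κ Φ t p O fv)) (ℓL κ Φ t p O.merged (gOf κ Φ t p O gv) (fOf κ Φ t p O fv)) (hL κ Φ t p O.merged (gOf κ Φ t p O gv) (fOf κ Φ t p O fv)) (kgR κ Φ t p O.merged mk) 0 (kgW κ Φ t p O.merged (gOf κ Φ t p O gv) (fOf κ Φ t p O fv) Wx)
        (kgNv0 κ Φ t p O.merged (gOf κ Φ t p O gv) (fOf κ Φ t p O fv) mk qx Wx)
        (kgM₁ (nL κ Φ t p O.merged (gOf κ Φ t p O gv) (fOf κ Φ t p O fv)) (ℓL κ Φ t p O.merged (gOf κ Φ t p O gv) (fOf κ Φ t p O fv)) (hL κ Φ t p O.merged (gOf κ Φ t p O gv) (fOf κ Φ t p O fv)) (kgR κ Φ t p O.merged mk) 0 (kgW κ Φ t p O.merged (gOf κ Φ t p O gv) (fOf κ Φ t p O fv) Wx)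
          (kgNv0 κ Φ t p O.merged (gOf κ Φ t p O gv) (fOf κ Φ t p O fv) mk qx Wx))
        (kgWm₂ (nL κ Φ t p O.merged (gOf κ Φ t p O gv) (fOf κ Φ t p O fv)) (ℓL κ Φ t p O.merged (gOf κ Φ t p O gv) (fOf κ Φ t p O fv)) (hL κ Φ t p O.merged (gOf κ Φ t p O gv) (fOf κ Φ t p O fv)) (kgR κ Φ t p O.merged mk) 0 (kgW κ Φ t p O.merged (gOf κ Φ t p O gv) (fOf κ Φ t p O fv) Wx)
          (kgNv0 κ Φ t p O.merged (gOf κ Φ t p O gv) (fOf κ Φ t p O fv) mk qx Wx))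
        (kgWp₂ (nL κ Φ t p O.merged (gOf κ Φ t p O gv) (fOf κ Φ t p O fv)) (ℓL κ Φ t p O.merged (gOf κ Φ t p O gv) (fOf κ Φ t p O fv)) (hL κ Φ t p O.merged (gOf κ Φ t p O gv) (fOf κ Φ t p O fv)) (kgR κ Φ t p O.merged mk) 0 (kgW κ Φ t p O.merged (gOf κ Φ t p O gv) (fOf κ Φ t p O fv) Wx)
          (kgNv0 κ Φ t p O.merged (gOf κ Φ t p O gv) (fOf κ Φ t p O fv) mk qx Wx))
        (kgM₂ (nL κ Φ t p O.merged (gOf κ Φ t p O gv) (fOf κ Φ t p O fv)) (ℓL κ Φ t p O.merged (gOf κ Φ t p O gv) (fOf κ Φ t p O fv)) (hL κ Φ t p O.merged (gOf κ Φ t p O gv) (fOf κ Φ t p O fv)) (vL κ Φ t p O.merged (gOf κ Φ t p O gv) (fOf κ Φ t p O fv)) (kgR κ Φ t p O.merged mk) 0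
          (kgq κ Φ t p O.merged (gOf κ Φ t p O gv) (fOf κ Φ t p O fv) qx) (kgW κ Φ t p O.merged (gOf κ Φ t p O gv) (fOf κ Φ t p O fv) Wx) (kgNv0 κ Φ t p O.merged (gOf κ Φ t p O gv) (fOf κ Φ t p O fv) mk qx Wx)))
      ≤ (Z : ℤ))
    -- the cells' radii against the seed (instance: `hRs5_TAT`-type lemma at the g-slot of record)
    (hRs5 : ∀ i, KS.Rs t O.merged mk + 1 ≤ 5 * ((fcellsA κ Φ t p O.merged (gOf κ Φ t p O gv) (fOf κ Φ t p O fv))).r i)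
    -- the four READING rows of the root's boxes (SkelFrmBChoiceRootReadX) — bridge region, corridor regions, last core, planar diameter of the cut world
    (hfoot₁ : ∀ w ∈ graphBall G t (Rπ κ Φ t p O.merged (gOf κ Φ t p O gv) (fOf κ Φ t p O fv) (SUS ex mx) q),
      rootFrame (φL κ Φ t p O.D O.DT.toDataN O.ori (gOf κ Φ t p O gv) (fOf κ Φ t p O fv)) t 1 w ∈
        Finset.Icc (KS.B0 κ Φ t p O.merged mk (gOf κ Φ t p O gv) (fOf κ Φ t p O fv)).regionLo (KS.B0 κ Φ t p O.merged mk (gOf κ Φ t p O gv) (fOf κ Φ t p O fv)).regionHi →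
      RootFootV (fcellsV κ Φ t p O.merged (gOf κ Φ t p O gv) (fOf κ Φ t p O fv) (cOf κ Φ t p O gv fv cv) (hOf κ Φ t p O gv fv hv)) (((0 : Fin 2), true) : MDir) ((fineOA κ Φ t p O.D O.DT.toDataN O.ori (gOf κ Φ t p O gv) (fOf κ Φ t p O fv)) w))
    (hfoot₂ : ∀ c₁ : V, (φL κ Φ t p O.D O.DT.toDataN O.ori (gOf κ Φ t p O gv) (fOf κ Φ t p O fv)) c₁ 0 - (φL κ Φ t p O.D O.DT.toDataN O.ori (gOf κ Φ t p O gv) (fOf κ Φ t p O fv)) t 0 =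
        KS.X1 κ Φ t p O.merged mk (gOf κ Φ t p O gv) (fOf κ Φ t p O fv) (kgq κ Φ t p O.merged (gOf κ Φ t p O gv) (fOf κ Φ t p O fv) qx) →
      (φL κ Φ t p O.D O.DT.toDataN O.ori (gOf κ Φ t p O gv) (fOf κ Φ t p O fv)) c₁ 1 - (φL κ Φ t p O.D O.DT.toDataN O.ori (gOf κ Φ t p O gv) (fOf κ Φ t p O fv)) t 1 =
        KS.Y1s κ Φ t p O.merged mk (gOf κ Φ t p O gv) (fOf κ Φ t p O fv) (kgq κ Φ t p O.merged (gOf κ Φ t p O gv) (fOf κ Φ t p O fv) qx) →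
      ∀ k ≤ (Skelφ.kgCorrSched ((kgRows0_of κ Φ t p O.merged (gOf κ Φ t p O gv) (fOf κ Φ t p O fv) mk qx Wx (eqNumL_of_atQ (atQ3_of_atQ3V hAt)) hgK).kgVals_ok₁ (KS.kgNR κ Φ t p O.merged mk (gOf κ Φ t p O gv) (fOf κ Φ t p O fv) qx Wx))
          ((kgRows0_of κ Φ t p O.merged (gOf κ Φ t p O gv) (fOf κ Φ t p O fv) mk qx Wx (eqNumL_of_atQ (atQ3_of_atQ3V hAt)) hgK).kgVals_ok₂ (KS.kgNR κ Φ t p O.merged mk (gOf κ Φ t p O gv) (fOf κ Φ t p O fv) qx Wx))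
          ((kgRows0_of κ Φ t p O.merged (gOf κ Φ t p O gv) (fOf κ Φ t p O fv) mk qx Wx (eqNumL_of_atQ (atQ3_of_atQ3V hAt)) hgK).kgVals_split (KS.kgNR κ Φ t p O.merged mk (gOf κ Φ t p O gv) (fOf κ Φ t p O fv) qx Wx))).N,
      ∀ w ∈ graphBall G t (Rπ κ Φ t p O.merged (gOf κ Φ t p O gv) (fOf κ Φ t p O fv) (SUS ex mx) q),
        Skelφ.runX (φL κ Φ t p O.D O.DT.toDataN O.ori (gOf κ Φ t p O gv) (fOf κ Φ t p O fv)) c₁ (nL κ Φ t p O.merged (gOf κ Φ t p O gv) (fOf κ Φ t p O fv)) (hL κ Φ t p O.merged (gOf κ Φ t p O gv) (fOf κ Φ t p O fv)) 1 w ∈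
          (Skelφ.kgCorrSched ((kgRows0_of κ Φ t p O.merged (gOf κ Φ t p O gv) (fOf κ Φ t p O fv) mk qx Wx (eqNumL_of_atQ (atQ3_of_atQ3V hAt)) hgK).kgVals_ok₁ (KS.kgNR κ Φ t p O.merged mk (gOf κ Φ t p O gv) (fOf κ Φ t p O fv) qx Wx))
            ((kgRows0_of κ Φ t p O.merged (gOf κ Φ t p O gv) (fOf κ Φ t p O fv) mk qx Wx (eqNumL_of_atQ (atQ3_of_atQ3V hAt)) hgK).kgVals_ok₂ (KS.kgNR κ Φ t p O.merged mk (gOf κ Φ t p O gv) (fOf κ Φ t p O fv) qx Wx))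
            ((kgRows0_of κ Φ t p O.merged (gOf κ Φ t p O gv) (fOf κ Φ t p O fv) mk qx Wx (eqNumL_of_atQ (atQ3_of_atQ3V hAt)) hgK).kgVals_split (KS.kgNR κ Φ t p O.merged mk (gOf κ Φ t p O gv) (fOf κ Φ t p O fv) qx Wx))).region k →
        RootFootV (fcellsV κ Φ t p O.merged (gOf κ Φ t p O gv) (fOf κ Φ t p O fv) (cOf κ Φ t p O gv fv cv) (hOf κ Φ t p O gv fv hv)) (((0 : Fin 2), true) : MDir) ((fineOA κ Φ t p O.D O.DT.toDataN O.ori (gOf κ Φ t p O gv) (fOf κ Φ t p O fv)) w))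
    (hlastf : ∀ c₁ : V, (φL κ Φ t p O.D O.DT.toDataN O.ori (gOf κ Φ t p O gv) (fOf κ Φ t p O fv)) c₁ 0 - (φL κ Φ t p O.D O.DT.toDataN O.ori (gOf κ Φ t p O gv) (fOf κ Φ t p O fv)) t 0 =
        KS.X1 κ Φ t p O.merged mk (gOf κ Φ t p O gv) (fOf κ Φ t p O fv) (kgq κ Φ t p O.merged (gOf κ Φ t p O gv) (fOf κ Φ t p O fv) qx) →
      (φL κ Φ t p O.D O.DT.toDataN O.ori (gOf κ Φ t p O gv) (fOf κ Φ t p O fv)) c₁ 1 - (φL κ Φ t p O.D O.DT.toDataN O.ori (gOf κ Φ t p O gv) (fOf κ Φ t p O fv)) t 1 =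
        KS.Y1s κ Φ t p O.merged mk (gOf κ Φ t p O gv) (fOf κ Φ t p O fv) (kgq κ Φ t p O.merged (gOf κ Φ t p O gv) (fOf κ Φ t p O fv) qx) →
      ∀ w ∈ graphBall G t (Rπ κ Φ t p O.merged (gOf κ Φ t p O gv) (fOf κ Φ t p O fv) (SUS ex mx) q),
        Skelφ.runX (φL κ Φ t p O.D O.DT.toDataN O.ori (gOf κ Φ t p O gv) (fOf κ Φ t p O fv)) c₁ (nL κ Φ t p O.merged (gOf κ Φ t p O gv) (fOf κ Φ t p O fv)) (hL κ Φ t p O.merged (gOf κ Φ t p O gv) (fOf κ Φ t p O fv)) 1 w ∈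
          ScheduleNP.core (Skelφ.kgCorrSched ((kgRows0_of κ Φ t p O.merged (gOf κ Φ t p O gv) (fOf κ Φ t p O fv) mk qx Wx (eqNumL_of_atQ (atQ3_of_atQ3V hAt)) hgK).kgVals_ok₁ (KS.kgNR κ Φ t p O.merged mk (gOf κ Φ t p O gv) (fOf κ Φ t p O fv) qx Wx))
            ((kgRows0_of κ Φ t p O.merged (gOf κ Φ t p O gv) (fOf κ Φ t p O fv) mk qx Wx (eqNumL_of_atQ (atQ3_of_atQ3V hAt)) hgK).kgVals_ok₂ (KS.kgNR κ Φ t p O.merged mk (gOf κ Φ t p O gv) (fOf κ Φ t p O fv) qx Wx))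
            ((kgRows0_of κ Φ t p O.merged (gOf κ Φ t p O gv) (fOf κ Φ t p O fv) mk qx Wx (eqNumL_of_atQ (atQ3_of_atQ3V hAt)) hgK).kgVals_split (KS.kgNR κ Φ t p O.merged mk (gOf κ Φ t p O gv) (fOf κ Φ t p O fv) qx Wx)))
            ((Skelφ.kgCorrSched ((kgRows0_of κ Φ t p O.merged (gOf κ Φ t p O gv) (fOf κ Φ t p O fv) mk qx Wx (eqNumL_of_atQ (atQ3_of_atQ3V hAt)) hgK).kgVals_ok₁ (KS.kgNR κ Φ t p O.merged mk (gOf κ Φ t p O gv) (fOf κ Φ t p O fv) qx Wx))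
              ((kgRows0_of κ Φ t p O.merged (gOf κ Φ t p O gv) (fOf κ Φ t p O fv) mk qx Wx (eqNumL_of_atQ (atQ3_of_atQ3V hAt)) hgK).kgVals_ok₂ (KS.kgNR κ Φ t p O.merged mk (gOf κ Φ t p O gv) (fOf κ Φ t p O fv) qx Wx))
              ((kgRows0_of κ Φ t p O.merged (gOf κ Φ t p O gv) (fOf κ Φ t p O fv) mk qx Wx (eqNumL_of_atQ (atQ3_of_atQ3V hAt)) hgK).kgVals_split (KS.kgNR κ Φ t p O.merged mk (gOf κ Φ t p O gv) (fOf κ Φ t p O fv) qx Wx))).N + 1) →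
        TargetFootV (fcellsV κ Φ t p O.merged (gOf κ Φ t p O gv) (fOf κ Φ t p O fv) (cOf κ Φ t p O gv fv cv) (hOf κ Φ t p O gv fv hv)) (bOf κ Φ t p O gv fv bv) (((0 : Fin 2), true) : MDir) ((fineOA κ Φ t p O.D O.DT.toDataN O.ori (gOf κ Φ t p O gv) (fOf κ Φ t p O fv)) w))
    (hDm : ∀ d ∈ ((((KSchA.mk (ΓQV κ Φ t p O gv fv (SUS ex mx) cv hv bv q) q κ.δ : KSchA V ℕ)).U0root (((0 : Fin 2), true) : MDir)).filter fun y => y ∈ graphBall G t (Rπ κ Φ t p O.merged (gOf κ Φ t p O gv) (fOf κ Φ t p O fv) (SUS ex mx) q)) \ O.merged.Λ t O.merged.k,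
      ∀ d' ∈ ((((KSchA.mk (ΓQV κ Φ t p O gv fv (SUS ex mx) cv hv bv q) q κ.δ : KSchA V ℕ)).U0root (((0 : Fin 2), true) : MDir)).filter fun y => y ∈ graphBall G t (Rπ κ Φ t p O.merged (gOf κ Φ t p O gv) (fOf κ Φ t p O fv) (SUS ex mx) q)) \ O.merged.Λ t O.merged.k,
        (φL κ Φ t p O.D O.DT.toDataN O.ori (gOf κ Φ t p O gv) (fOf κ Φ t p O fv)) d - (φL κ Φ t p O.D O.DT.toDataN O.ori (gOf κ Φ t p O gv) (fOf κ Φ t p O fv)) d' ∈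
          box 2 (mRS κ Φ t p O.merged (gOf κ Φ t p O gv) (fOf κ Φ t p O fv) (mx κ Φ t p O.merged (gOf κ Φ t p O gv) (fOf κ Φ t p O fv)))) :
    ∃ n, n ≤ LfQ κ.K₀ ∧ ∃ (c : V) (Rπ : ℕ) (W : Sym2 V → unitInterval) (s : Fin (n + 1) → KNLevels.TStep (winGraph G c Rπ))
      (T' : Fin (n + 1) → Finset V) (η' : ℝ),
      (∀ T : Finset V, (prodBernoulli W).real (⋃ t' ∈ T, openConn (ΓQV κ Φ t p O gv fv (SUS ex mx) cv hv bv q).root t') ≤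
        (prodBernoulli (pinW (KNLevels.lattW G q) ↑((⟨ΓQV κ Φ t p O gv fv (SUS ex mx) cv hv bv q, q, κ.δ⟩ : KSchA V ℕ).U₀ G)
          ↑((⟨ΓQV κ Φ t p O gv fv (SUS ex mx) cv hv bv q, q, κ.δ⟩ : KSchA V ℕ).U₀ G))).real
          (⋃ t' ∈ (↑T : Set V), openConnIn (↑((ΓQV κ Φ t p O gv fv (SUS ex mx) cv hv bv q).Q (ΓQV κ Φ t p O gv fv (SUS ex mx) cv hv bv q).a₀ 0 ∪
            (ΓQV κ Φ t p O gv fv (SUS ex mx) cv hv bv q).Ewv (ΓQV κ Φ t p O gv fv (SUS ex mx) cv hv bv q).a₀ 0 (((0 : Fin 2), true) : MDir)) : Set V)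
            (ΓQV κ Φ t p O gv fv (SUS ex mx) cv hv bv q).root t')) ∧
      (∀ i : Fin (n + 1), (s i).L.o = (ΓQV κ Φ t p O gv fv (SUS ex mx) cv hv bv q).root) ∧
      (∀ i : Fin n, T' (Fin.castSucc i) ⊆ (s i.succ).L.X 0) ∧ (∀ i : Fin (n + 1), T' i ⊆ (s i).T) ∧
      (∀ i : Fin (n + 1), (s i).KitsAtF W q Φ.Δ (κ.δr 0)) ∧ η' ≤ κ.δr 0 / 2 ∧
      (∀ i : Fin (n + 1), (prodBernoulli W).real (⋃ t' ∈ (s i).T \ T' i, openConn (ΓQV κ Φ t p O gv fv (SUS ex mx) cv hv bv q).root t') ≤ η') ∧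
      1 - κ.δr 0 < (prodBernoulli W).real (s 0).L.reachB ∧
      T' (Fin.last n) ⊆ (ΓQV κ Φ t p O gv fv (SUS ex mx) cv hv bv q).M (ΓQV κ Φ t p O gv fv (SUS ex mx) cv hv bv q).a₀ ((0 : Site 2) + stepVec (((0 : Fin 2), true) : MDir)) := by
  have hAt' := atQ3_of_atQ3V hAt
  -- facts at `AtQNQ`
  have hN : EqNumL κ Φ t p O.merged (gOf κ Φ t p O gv) (fOf κ Φ t p O fv) := eqNumL_of_atQ hAt'
  obtain ⟨hn1, -⟩ := one_le_of_eqNumL κ Φ t p O.merged (gOf κ Φ t p O gv) (fOf κ Φ t p O fv) hN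
  obtain ⟨-, -, -, hCq⟩ := factsNS_of_atQ hAt'
  have hδ0 : 0 < κ.δr 0 := (κ.hδr 0).1
  have hkit : Neg.δkit κ Φ ≤ κ.δr 0 := Neg.δkit_le_δr κ Φ (n := 0) (by norm_num)
  have hη : Neg.η κ Φ ≤ κ.δr 0 / 2 := by
    unfold Neg.η; exact div_le_div_of_nonneg_right hkit (by norm_num)
  have hstepφ := steps_φL κ Φ t p O.D O.DT.toDataN O.ori (gOf κ Φ t p O gv) (fOf κ Φ t p O fv)
  -- the RootRun floors at this window
  obtain ⟨-, -, hs958, -, -, -, -⟩ := KS.rootRun_floors κ Φ t p O.merged mk (gOf κ Φ t p O gv) (fOf κ Φ t p O fv) hN hgK hg2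
  obtain ⟨hnR, hrow⟩ := KS.hrowR κ Φ t p O.merged mk (gOf κ Φ t p O gv) (fOf κ Φ t p O fv) qx Wx hN hgK hg2 hqx hWx hf
  -- the landing vertex on the terminal's shear line ((R-47)(a))
  obtain ⟨c₁, hc₁, hX, hY⟩ := KS.exists_landing0s κ Φ t p O.merged mk (gOf κ Φ t p O gv) (fOf κ Φ t p O fv) (kgq κ Φ t p O.merged (gOf κ Φ t p O gv) (fOf κ Φ t p O fv) qx) hstepφ
  -- the bridge of record
  have hℓB27 := ℓB0_ge_of_atQ3 hAt' mk
  have hℓB3 : 3 ≤ KS.ℓB0 κ Φ t p O.merged mk := by omega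
  obtain ⟨hQb, hFb, -⟩ := bridge0Sets_of_atQ3 hAt' mk
  have hbridge := hbridge0K_of_atQ3_δr hAt' h1 mk hPx
  -- the ex-floors read into the window radius `Rπ`
  have hr₀R := ex_le_Rπ κ Φ t p O.merged (gOf κ Φ t p O gv) (fOf κ Φ t p O fv) ex mx q hexRL
  have hr₀bR := ex_le_Rπ κ Φ t p O.merged (gOf κ Φ t p O gv) (fOf κ Φ t p O fv) ex mx q hexRB
  have hYbπ := ex_le_Rπ κ Φ t p O.merged (gOf κ Φ t p O gv) (fOf κ Φ t p O fv) ex mx q hexYb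
  have hZπ := ex_le_Rπ κ Φ t p O.merged (gOf κ Φ t p O gv) (fOf κ Φ t p O fv) ex mx q hexZ
  have hc1R : ((KS.B0 κ Φ t p O.merged mk (gOf κ Φ t p O gv) (fOf κ Φ t p O fv)).core1Lo 0).natAbs +
      ((KS.B0 κ Φ t p O.merged mk (gOf κ Φ t p O gv) (fOf κ Φ t p O fv)).core1Lo 1).natAbs ≤ Rπ κ Φ t p O.merged (gOf κ Φ t p O gv) (fOf κ Φ t p O fv) (SUS ex mx) q :=
    (KS.core1Lo_0_l1 κ Φ t p O.merged mk (gOf κ Φ t p O gv) (fOf κ Φ t p O fv)).trans hYbπ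
  -- the cross-link budget `prB0 + ℓB0 + 5R'0 + 2 ≤ W` ((R-47)(b): `sL ≥ M_L − 1 ≥ g − 1 ≥ 2f + 5R'0 + 2`)
  have hprB := KS.le_prB0 κ Φ t p O.merged mk
  have hfx : KS.Rs t O.merged mk + KS0.R'0 κ Φ t p O.merged mk + KS.prB0 κ Φ t p O.merged mk + 1 ≤ fOf κ Φ t p O fv := by
    have h := hf; rw [KS.fxR0_eq] at h; exact h
  have hML := (ML_le_ML κ Φ t p O.merged (gOf κ Φ t p O gv)).2
  have hsL := ML_sub_one_le_kgSL κ Φ t p O.merged (gOf κ Φ t p O gv) (fOf κ Φ t p O fv) hN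
  have hsL0 : (0 : ℤ) ≤ kgSL (nL κ Φ t p O.merged (gOf κ Φ t p O gv) (fOf κ Φ t p O fv)) (ℓL κ Φ t p O.merged (gOf κ Φ t p O gv) (fOf κ Φ t p O fv)) (hL κ Φ t p O.merged (gOf κ Φ t p O gv) (fOf κ Φ t p O fv)) := by
    linarith
  have hW : ((KS.prB0 κ Φ t p O.merged mk : ℕ) : ℤ) + (KS.ℓB0 κ Φ t p O.merged mk) + 5 * (KS0.R'0 κ Φ t p O.merged mk : ℤ) + 2 ≤
      (kgW κ Φ t p O.merged (gOf κ Φ t p O gv) (fOf κ Φ t p O fv) Wx : ℕ) := by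
    have hWx0 : (0 : ℤ) ≤ (Wx : ℤ) := by positivity
    have h1 : ((ML κ Φ t p O.merged (gOf κ Φ t p O gv) : ℕ) : ℤ) - 1 ≤ (kgW κ Φ t p O.merged (gOf κ Φ t p O gv) (fOf κ Φ t p O fv) Wx : ℕ) := by
      unfold kgW; push_cast; rw [Int.toNat_of_nonneg hsL0]; linarith
    have h2 : ((gOf κ Φ t p O gv : ℕ) : ℤ) ≤ ((ML κ Φ t p O.merged (gOf κ Φ t p O gv) : ℕ) : ℤ) := by exact_mod_cast hML
    have h3 : 2 * ((fOf κ Φ t p O fv : ℕ) : ℤ) + 5 * (KS0.R'0 κ Φ t p O.merged mk : ℤ) + 3 ≤ ((gOf κ Φ t p O gv : ℕ) : ℤ) := by exact_mod_cast hfg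
    have h4n : KS.prB0 κ Φ t p O.merged mk + 1 ≤ fOf κ Φ t p O fv := by have := hfx; omega
    have h4 : ((KS.prB0 κ Φ t p O.merged mk : ℕ) : ℤ) + 1 ≤ ((fOf κ Φ t p O fv : ℕ) : ℤ) := by exact_mod_cast h4n
    have h5n : 3 * KS.ℓB0 κ Φ t p O.merged mk ≤ KS.prB0 κ Φ t p O.merged mk := by have := hprB.2; omega
    have h5 : 3 * ((KS.ℓB0 κ Φ t p O.merged mk : ℕ) : ℤ) ≤ ((KS.prB0 κ Φ t p O.merged mk : ℕ) : ℤ) := by exact_mod_cast h5n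
    linarith
  have hRq : KS0.R'0 κ Φ t p O.merged mk ≤ kgq κ Φ t p O.merged (gOf κ Φ t p O gv) (fOf κ Φ t p O fv) qx := by
    unfold kgq; omega
  -- the depth row: `D0s + 13·(reach at N_R) ≤ D0s + Z + 13·sL ≤ Rπ`
  have hreach := KS.reachR1_le κ Φ t p O.merged mk (gOf κ Φ t p O gv) (fOf κ Φ t p O fv) qx Wx hN hgK hg2 hqx hWx hf (Z : ℤ) hZ
  have hRD : ((KS.D0s κ Φ t p O.merged mk (gOf κ Φ t p O gv) (fOf κ Φ t p O fv) (kgq κ Φ t p O.merged (gOf κ Φ t p O gv) (fOf κ Φ t p O fv) qx) : ℕ) : ℤ) +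
      (10 + 3) * ((((KS.kgNR κ Φ t p O.merged mk (gOf κ Φ t p O gv) (fOf κ Φ t p O fv) qx Wx : ℕ) : ℤ) + 1) * (nL κ Φ t p O.merged (gOf κ Φ t p O gv) (fOf κ Φ t p O fv) : ℤ) +
        kgZ₀ (nL κ Φ t p O.merged (gOf κ Φ t p O gv) (fOf κ Φ t p O fv)) (vL κ Φ t p O.merged (gOf κ Φ t p O gv) (fOf κ Φ t p O fv)) (KS0.R'0 κ Φ t p O.merged mk) 0 (kgq κ Φ t p O.merged (gOf κ Φ t p O gv) (fOf κ Φ t p O fv) qx)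
          (KS.kgNR κ Φ t p O.merged mk (gOf κ Φ t p O gv) (fOf κ Φ t p O fv) qx Wx)
          (kgM₁ (nL κ Φ t p O.merged (gOf κ Φ t p O gv) (fOf κ Φ t p O fv)) (ℓL κ Φ t p O.merged (gOf κ Φ t p O gv) (fOf κ Φ t p O fv)) (hL κ Φ t p O.merged (gOf κ Φ t p O gv) (fOf κ Φ t p O fv)) (KS0.R'0 κ Φ t p O.merged mk) 0 (kgW κ Φ t p O.merged (gOf κ Φ t p O gv) (fOf κ Φ t p O fv) Wx)
            (KS.kgNR κ Φ t p O.merged mk (gOf κ Φ t p O gv) (fOf κ Φ t p O fv) qx Wx))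
          (kgM₂ (nL κ Φ t p O.merged (gOf κ Φ t p O gv) (fOf κ Φ t p O fv)) (ℓL κ Φ t p O.merged (gOf κ Φ t p O gv) (fOf κ Φ t p O fv)) (hL κ Φ t p O.merged (gOf κ Φ t p O gv) (fOf κ Φ t p O fv)) (vL κ Φ t p O.merged (gOf κ Φ t p O gv) (fOf κ Φ t p O fv)) (KS0.R'0 κ Φ t p O.merged mk) 0
            (kgq κ Φ t p O.merged (gOf κ Φ t p O gv) (fOf κ Φ t p O fv) qx) (kgW κ Φ t p O.merged (gOf κ Φ t p O gv) (fOf κ Φ t p O fv) Wx) (KS.kgNR κ Φ t p O.merged mk (gOf κ Φ t p O gv) (fOf κ Φ t p O fv) qx Wx)) +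
        kgZ₁ (nL κ Φ t p O.merged (gOf κ Φ t p O gv) (fOf κ Φ t p O fv)) (ℓL κ Φ t p O.merged (gOf κ Φ t p O gv) (fOf κ Φ t p O fv)) (hL κ Φ t p O.merged (gOf κ Φ t p O gv) (fOf κ Φ t p O fv)) (KS0.R'0 κ Φ t p O.merged mk) 0 (kgW κ Φ t p O.merged (gOf κ Φ t p O gv) (fOf κ Φ t p O fv) Wx)
          (KS.kgNR κ Φ t p O.merged mk (gOf κ Φ t p O gv) (fOf κ Φ t p O fv) qx Wx)
          (kgM₁ (nL κ Φ t p O.merged (gOf κ Φ t p O gv) (fOf κ Φ t p O fv)) (ℓL κ Φ t p O.merged (gOf κ Φ t p O gv) (fOf κ Φ t p O fv)) (hL κ Φ t p O.merged (gOf κ Φ t p O gv) (fOf κ Φ t p O fv)) (KS0.R'0 κ Φ t p O.merged mk) 0 (kgW κ Φ t p O.merged (gOf κ Φ t p O gv) (fOf κ Φ t p O fv) Wx)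
            (KS.kgNR κ Φ t p O.merged mk (gOf κ Φ t p O gv) (fOf κ Φ t p O fv) qx Wx))
          (kgWm₂ (nL κ Φ t p O.merged (gOf κ Φ t p O gv) (fOf κ Φ t p O fv)) (ℓL κ Φ t p O.merged (gOf κ Φ t p O gv) (fOf κ Φ t p O fv)) (hL κ Φ t p O.merged (gOf κ Φ t p O gv) (fOf κ Φ t p O fv)) (KS0.R'0 κ Φ t p O.merged mk) 0 (kgW κ Φ t p O.merged (gOf κ Φ t p O gv) (fOf κ Φ t p O fv) Wx)
            (KS.kgNR κ Φ t p O.merged mk (gOf κ Φ t p O gv) (fOf κ Φ t p O fv) qx Wx))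
          (kgWp₂ (nL κ Φ t p O.merged (gOf κ Φ t p O gv) (fOf κ Φ t p O fv)) (ℓL κ Φ t p O.merged (gOf κ Φ t p O gv) (fOf κ Φ t p O fv)) (hL κ Φ t p O.merged (gOf κ Φ t p O gv) (fOf κ Φ t p O fv)) (KS0.R'0 κ Φ t p O.merged mk) 0 (kgW κ Φ t p O.merged (gOf κ Φ t p O gv) (fOf κ Φ t p O fv) Wx)
            (KS.kgNR κ Φ t p O.merged mk (gOf κ Φ t p O gv) (fOf κ Φ t p O fv) qx Wx))
          (kgM₂ (nL κ Φ t p O.merged (gOf κ Φ t p O gv) (fOf κ Φ t p O fv)) (ℓL κ Φ t p O.merged (gOf κ Φ t p O gv) (fOf κ Φ t p O fv)) (hL κ Φ t p O.merged (gOf κ Φ t p O gv) (fOf κ Φ t p O fv)) (vL κ Φ t p O.merged (gOf κ Φ t p O gv) (fOf κ Φ t p O fv)) (KS0.R'0 κ Φ t p O.merged mk) 0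
            (kgq κ Φ t p O.merged (gOf κ Φ t p O gv) (fOf κ Φ t p O fv) qx) (kgW κ Φ t p O.merged (gOf κ Φ t p O gv) (fOf κ Φ t p O fv) Wx) (KS.kgNR κ Φ t p O.merged mk (gOf κ Φ t p O gv) (fOf κ Φ t p O fv) qx Wx))) ≤
      Rπ κ Φ t p O.merged (gOf κ Φ t p O gv) (fOf κ Φ t p O fv) (SUS ex mx) q := by
    have h1 : ((KS.D0s κ Φ t p O.merged mk (gOf κ Φ t p O gv) (fOf κ Φ t p O fv) (kgq κ Φ t p O.merged (gOf κ Φ t p O gv) (fOf κ Φ t p O fv) qx) : ℕ) : ℤ) + (Z : ℤ) +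
        13 * kgSL (nL κ Φ t p O.merged (gOf κ Φ t p O gv) (fOf κ Φ t p O fv)) (ℓL κ Φ t p O.merged (gOf κ Φ t p O gv) (fOf κ Φ t p O fv)) (hL κ Φ t p O.merged (gOf κ Φ t p O gv) (fOf κ Φ t p O fv)) ≤
        Rπ κ Φ t p O.merged (gOf κ Φ t p O gv) (fOf κ Φ t p O fv) (SUS ex mx) q := by
      have h := hZπ; zify at h; rw [Int.toNat_of_nonneg hsL0] at h; linarith
    have e : ((10 : ℤ) + 3) = 13 := by norm_num
    rw [e]
    unfold kgR at hreach
    linarith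
  -- assemble: the skeleton at the values of record
  have HK := kgRows0_of κ Φ t p O.merged (gOf κ Φ t p O gv) (fOf κ Φ t p O fv) mk qx Wx (eqNumL_of_atQ (atQ3_of_atQ3V hAt)) hgK
  have hmain := rootLegAt_frmQ3KV_fst LfQ hAt h1 hp0 hp1 mk HK
    (KS.kgNR κ Φ t p O.merged mk (gOf κ Φ t p O gv) (fOf κ Φ t p O fv) qx Wx)
    (Rb := KS.RB0 κ Φ t p O.merged mk) hr₀R hr₀bR
    (hRQ_RT κ Φ t p O.merged (gOf κ Φ t p O gv) (fOf κ Φ t p O fv) (cOf κ Φ t p O gv fv cv) (SUS ex mx) q)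
    (hRB_RT κ Φ t p O.merged (gOf κ Φ t p O gv) (fOf κ Φ t p O fv) (cOf κ Φ t p O gv fv cv) (SUS ex mx) q _)
    (hRQ'_RT κ Φ t p O.merged (gOf κ Φ t p O gv) (fOf κ Φ t p O fv) (cOf κ Φ t p O gv fv cv) (SUS ex mx) q _)
    (hRM_RT κ Φ t p O.merged (gOf κ Φ t p O gv) (fOf κ Φ t p O fv) (cOf κ Φ t p O gv fv cv) (SUS ex mx) q _)
    (fat_le_Rπ κ Φ t p O.merged (gOf κ Φ t p O gv) (fOf κ Φ t p O fv) ex mx q hC)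
    (fun i => by rw [fcellsV_r]; exact hRs5 i)
    (hkR_hop_prism κ Φ t p O.merged (gOf κ Φ t p O gv) (fOf κ Φ t p O fv) hN)
    (by
      have h := hfR_hop_fst κ Φ t p O.merged (gOf κ Φ t p O gv) (fOf κ Φ t p O fv) hN
        (c₀ := (fcellsV κ Φ t p O.merged (gOf κ Φ t p O gv) (fOf κ Φ t p O fv) (cOf κ Φ t p O gv fv cv) (hOf κ Φ t p O gv fv hv)).c 0)
        ((fcellsV κ Φ t p O.merged (gOf κ Φ t p O gv) (fOf κ Φ t p O fv) (cOf κ Φ t p O gv fv cv) (hOf κ Φ t p O gv fv hv)).hcr 0)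
      simpa only [fcellsV_r] using h)
    c₁ hc₁ hRD
    (KS.B0 κ Φ t p O.merged mk (gOf κ Φ t p O gv) (fOf κ Φ t p O fv)) (B0_ok_of_atQ3 hAt' mk)
    (KS.B0_lo_le_hi κ Φ t p O.merged mk (gOf κ Φ t p O gv) (fOf κ Φ t p O fv))
    (KS.R'0_le_B0_R' κ Φ t p O.merged mk (gOf κ Φ t p O gv) (fOf κ Φ t p O fv))
    (KS.B0_core1_le κ Φ t p O.merged mk (gOf κ Φ t p O gv) (fOf κ Φ t p O fv) hℓB3) hc1R
    (KS.hhopB_0 κ Φ t p O.merged mk (gOf κ Φ t p O gv) (fOf κ Φ t p O fv) _ _ hn1)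
    (KS.hclear₁_0_of_floor κ Φ t p O.merged mk (gOf κ Φ t p O gv) (fOf κ Φ t p O fv) hf)
    _ _ hQb hFb hbridge
    hfoot₁ (hfoot₂ c₁ hX hY) (hlastf c₁ hX hY) hnR hrow
    (by rw [hX]; exact KS.hX₁_0 κ Φ t p O.merged mk (gOf κ Φ t p O gv) (fOf κ Φ t p O fv) _)
    (fun w _ hw => KS.hx_0s κ Φ t p O.merged mk (gOf κ Φ t p O gv) (fOf κ Φ t p O fv) _ hN HK (KS.kgNR κ Φ t p O.merged mk (gOf κ Φ t p O gv) (fOf κ Φ t p O fv) qx Wx) hW hRq hX hY hw)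
    hDm
    (hR₁_US κ Φ t p O.merged (gOf κ Φ t p O gv) (fOf κ Φ t p O fv) ex mx q hCq (oL κ Φ t p O.D O.DT.toDataN O.ori (gOf κ Φ t p O gv) (fOf κ Φ t p O fv)) hη t
      (Skelφ.fatRadius Φ.frame hC O.merged.k))
    (SRex_fat_le_Rπ_sub κ Φ t p O.merged (gOf κ Φ t p O gv) (fOf κ Φ t p O fv) ex mx q hC hexRB)
    (SRex_fat_le_Rπ_sub κ Φ t p O.merged (gOf κ Φ t p O gv) (fOf κ Φ t p O fv) ex mx q hC hexRL)
    (by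
      rw [ChainPlanar.BridgePrm.bridgeFrame_N]
      exact KS.hlen_R1 κ Φ t p O.merged mk (gOf κ Φ t p O gv) (fOf κ Φ t p O fv) qx Wx hN hgK hg2 hqx hWx hf hx3)
  exact hmain

end NegB

end PlanarSkeletonFrmFrom

end Transplant

end Summit.CriticalPhenomena.PercolationContinuityZ3.Theorems

end
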